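import Summits.FinalStateConjecture.FinalStateConjecture.Theorems.EIHFluxBalanceInertialRecessionStubCoerMomQuantVar
import Summits.FinalStateConjecture.FinalStateConjecture.Theorems.EIHFluxBalanceInertialRecessionStubCoerMomQuantJets
import Literature.Geometry.Lorentzian.BoostedKerrDilation

/-!
# Route EIHFluxBalance — `InertialRecession` (E′), line `SketchCleanExcision`, skeleton r13,
# stub `stub_coerMomKernel` (Bk), analytic half, part 2: Kerr–Schild SCALING of the momentum rows

Helper file for the crux `stmt-FinalStateConjecture-17403`
(`Summit.FinalStateConjecture.FinalStateConjecture.Theses.EIHFluxBalance.InertialRecession`, E′),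
registered stub `stub_coerMomKernel` (Bk) of skeleton r13 (seat 1, analytic half of Bk).

The painted summand `K = boostedKerrBilin L 0 M a` (frame operator `S = Λ⁻¹`) and the lab
first-variation field `Var_{(M,a,A,d)}` of an infinitesimal rest-frame Poincaré motion `(A, d)`
are homogeneous under the dilation `z ↦ c z` (`c > 0`) against the parameters
`(c⁻¹M, c⁻¹a, cA, d)` (Kerr–Schild scaling `g_{M,a}(c p) = g_{c⁻¹M, c⁻¹a}(p)`,
`Kerr.bilin_smul_smul`):

* `bk_kerr_bilin_comp_smul`, `bk_fderiv_kerr_bilin_smul` — the family and its derivative;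
* `bk_var_comp_smul` — `Var_{(c⁻¹M,c⁻¹a,cA,d)}(z) = c • Var_{(M,a,A,d)}(c z)`;
* `bk_model_comp_smul` — the first-order modulated model `K + x⁰Var` composed with the dilation IS
  the model with the dilated parameters;
* `bk_isMetricOn_boostedKerrBilin` — the painted summand is a field of metric components on
  `{r(S·) > 0}`;
* `bk_row_scaling` — **the momentum rows scale**:
  `rows_{(M,a,A,d)}(c x) = c⁻² rows_{(c⁻¹M,c⁻¹a,cA,d)}(x)` at a slice point (`ricAt_comp_zoom`).

No definitions, no named facts, no `sorry`.
-/

set_option linter.dupNamespace false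
set_option maxSynthPendingDepth 3

noncomputable section

open Set Function Filter ContinuousLinearMap Literature.Geometry.Lorentzian
  Literature.Geometry.Lorentzian.MetricCoord
open scoped Topology ContDiff

namespace Summit.FinalStateConjecture.FinalStateConjecture.Theorems.SublinearIsFree.Slaving

/-! ### Kerr–Schild scaling of the family and of its derivative -/

/-- **Kerr–Schild scaling, composed form**: `g_{c⁻¹M, c⁻¹a} = g_{M,a} ∘ (c •)` (`c > 0`).
[cite: KerrSchild1965, §2] -/
theorem bk_kerr_bilin_comp_smul {c : ℝ} (hc : 0 < c) (M a : ℝ) :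
    Kerr.bilin (c⁻¹ * M) (c⁻¹ * a) = fun p : E4 ↦ Kerr.bilin M a (c • p) := by
  funext p
  have h := Kerr.bilin_smul_smul hc (c⁻¹ * M) (c⁻¹ * a) p
  rw [mul_inv_cancel_left₀ hc.ne', mul_inv_cancel_left₀ hc.ne'] at h
  exact h.symm

/-- **The derivative scales**: `D g_{M,a}(c p) = c⁻¹ D g_{c⁻¹M,c⁻¹a}(p)` (chain rule through the
dilation; `fderiv_comp_smul`, unconditional). [cite: KerrSchild1965, §2] -/
theorem bk_fderiv_kerr_bilin_smul {c : ℝ} (hc : 0 < c) (M a : ℝ) (p : E4) :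
    fderiv ℝ (Kerr.bilin M a) (c • p) = c⁻¹ • fderiv ℝ (Kerr.bilin (c⁻¹ * M) (c⁻¹ * a)) p := by
  rw [bk_kerr_bilin_comp_smul hc M a]
  rw [show (fun p : E4 ↦ Kerr.bilin M a (c • p)) = (Kerr.bilin M a <| c • ·) from rfl,
    fderiv_comp_smul c, smul_smul, inv_mul_cancel₀ hc.ne', one_smul]

/-! ### Scaling of the first-variation field and of the modulated model -/

/-- **Scaling of the lab first-variation field**:
`Var_{(c⁻¹M, c⁻¹a, cA, d)}(z) = c • Var_{(M,a,A,d)}(c z)` for the frame operator `S`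
(`Var_{(M,a,A,d)}(z) = Dg(Sz)(A(Sz) + d)(S·,S·) + g(Sz)(AS·,S·) + g(Sz)(S·,AS·)`). [folklore] -/
theorem bk_var_comp_smul (M a : ℝ) (S A : E4 →L[ℝ] E4) (d : E4) {c : ℝ} (hc : 0 < c) (z : E4) :
    (fderiv ℝ (Kerr.bilin (c⁻¹ * M) (c⁻¹ * a)) (S z) ((c • A) (S z) + d)).bilinearComp S S
        + (Kerr.bilin (c⁻¹ * M) (c⁻¹ * a) (S z)).bilinearComp ((c • A).comp S) S
        + (Kerr.bilin (c⁻¹ * M) (c⁻¹ * a) (S z)).bilinearComp S ((c • A).comp S)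
      = c • ((fderiv ℝ (Kerr.bilin M a) (S (c • z)) (A (S (c • z)) + d)).bilinearComp S S
        + (Kerr.bilin M a (S (c • z))).bilinearComp (A.comp S) S
        + (Kerr.bilin M a (S (c • z))).bilinearComp S (A.comp S)) := by
  have hK : Kerr.bilin M a (c • S z) = Kerr.bilin (c⁻¹ * M) (c⁻¹ * a) (S z) := by
    rw [bk_kerr_bilin_comp_smul hc M a]
  have hD : fderiv ℝ (Kerr.bilin M a) (c • S z) =
      c⁻¹ • fderiv ℝ (Kerr.bilin (c⁻¹ * M) (c⁻¹ * a)) (S z) := bk_fderiv_kerr_bilin_smul hc M a _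
  ext u w
  simp only [_root_.add_apply, _root_.smul_apply, ContinuousLinearMap.bilinearComp_apply,
    ContinuousLinearMap.coe_comp, comp_apply, map_smul, hK, hD, map_add, smul_eq_mul]
  field_simp

/-- **The modulated model commutes with the dilation**:
`(K_{(M,a)} + x⁰Var_{(M,a,A,d)}) ∘ (c •) = K_{(c⁻¹M,c⁻¹a)} + x⁰Var_{(c⁻¹M,c⁻¹a,cA,d)}` as fields on
`E4`, for the painted summand with frame `L` and its frame operator `S = Λ⁻¹`
(`boostedKerrBilin_smul_inv`, `bk_var_comp_smul`). [cite: KerrSchild1965, §2] -/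
theorem bk_model_comp_smul (L : lorentzGroup) (M a : ℝ) (A : E4 →L[ℝ] E4) (d : E4) {c : ℝ}
    (hc : 0 < c) :
    (fun w : E4 ↦ (fun z : E4 ↦ boostedKerrBilin L 0 M a z + (z 0) • ((fderiv ℝ (Kerr.bilin M a) (((L : E4 ≃L[ℝ] E4).symm : E4 →L[ℝ] E4) z) (A (((L : E4 ≃L[ℝ] E4).symm : E4 →L[ℝ] E4) z) + d)).bilinearComp ((L : E4 ≃L[ℝ] E4).symm : E4 →L[ℝ] E4) ((L : E4 ≃L[ℝ] E4).symm : E4 →L[ℝ] E4) + (Kerr.bilin M a (((L : E4 ≃L[ℝ] E4).symm : E4 →L[ℝ] E4) z)).bilinearComp (A.comp ((L : E4 ≃L[ℝ] E4).symm : E4 →L[ℝ] E4)) ((L : E4 ≃L[ℝ] E4).symm : E4 →L[ℝ] E4) + (Kerr.bilin M a (((L : E4 ≃L[ℝ] E4).symm : E4 →L[ℝ] E4) z)).bilinearComp ((L : E4 ≃L[ℝ] E4).symm : E4 →L[ℝ] E4) (A.comp ((L : E4 ≃L[ℝ] E4).symm : E4 →L[ℝ] E4)))) (c • w))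
      = fun z : E4 ↦ boostedKerrBilin L 0 (c⁻¹ * M) (c⁻¹ * a) z + (z 0) • ((fderiv ℝ (Kerr.bilin (c⁻¹ * M) (c⁻¹ * a)) (((L : E4 ≃L[ℝ] E4).symm : E4 →L[ℝ] E4) z) ((c • A) (((L : E4 ≃L[ℝ] E4).symm : E4 →L[ℝ] E4) z) + d)).bilinearComp ((L : E4 ≃L[ℝ] E4).symm : E4 →L[ℝ] E4) ((L : E4 ≃L[ℝ] E4).symm : E4 →L[ℝ] E4) + (Kerr.bilin (c⁻¹ * M) (c⁻¹ * a) (((L : E4 ≃L[ℝ] E4).symm : E4 →L[ℝ] E4) z)).bilinearComp ((c • A).comp ((L : E4 ≃L[ℝ] E4).symm : E4 →L[ℝ] E4)) ((L : E4 ≃L[ℝ] E4).symm : E4 →L[ℝ] E4) + (Kerr.bilin (c⁻¹ * M) (c⁻¹ * a) (((L : E4 ≃L[ℝ] E4).symm : E4 →L[ℝ] E4) z)).bilinearComp ((L : E4 ≃L[ℝ] E4).symm : E4 →L[ℝ] E4) ((c • A).comp ((L : E4 ≃L[ℝ] E4).symm : E4 →L[ℝ] E4))) := by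
  set S : E4 →L[ℝ] E4 := ((L : E4 ≃L[ℝ] E4).symm : E4 →L[ℝ] E4) with hS
  funext z
  simp only []
  rw [bk_var_comp_smul M a S A d hc z, boostedKerrBilin_smul_inv hc L 0 M a z, smul_zero,
    smul_smul]
  congr 1
  rw [show ((c • z) 0 : ℝ) = c * z 0 from rfl, mul_comm c (z 0)]

/-! ### The painted summand as metric components -/

/-- **The painted summand is a field of metric components** on the lab region `{r_a(Λ⁻¹z) > 0}`
(`isMetricOn_kerr_bilin` pulled back along the change of coordinates `z ↦ Λ⁻¹z`).
[cite: KerrSchild1965, §2] -/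
theorem bk_isMetricOn_boostedKerrBilin (L : lorentzGroup) (M a : ℝ) :
    IsMetricOn (boostedKerrBilin L 0 M a) (poincareInv L 0 ⁻¹' (Kerr.region a 0 : Set E4)) := by
  rw [← pullMetric_kerr_bilin_poincareInv]
  exact (isMetricOn_kerr_bilin M a).isMetricOn_pullMetric (isCoordChangeOn_poincareInv L 0 a)

/-- Membership in the lab region `{r_a(Λ⁻¹z) > 0}`. [folklore] -/
theorem bk_mem_region_iff (L : lorentzGroup) (a : ℝ) (z : E4) :
    z ∈ poincareInv L 0 ⁻¹' (Kerr.region a 0 : Set E4) ↔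
      0 < Kerr.radius a (((L : E4 ≃L[ℝ] E4).symm : E4 →L[ℝ] E4) z) := by
  rw [mem_preimage, SetLike.mem_coe, Kerr.mem_region, max_self]
  simp [poincareInv]

/-! ### Scaling of the momentum rows -/

set_option maxHeartbeats 1600000 in
/-- **The momentum rows of the first-order modulated model scale.** At a slice point `x`
(`x⁰ = 0`) with `r_a(S(cx)) > 0`, `c > 0`:
`Ric(K + x⁰Var_{(M,a,A,d)})(c x)(♯_K dx⁰, e) = c⁻² Ric(K' + x⁰Var_{(c⁻¹M,c⁻¹a,cA,d)})(x)(♯_{K'} dx⁰, e)`,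
`K' = boostedKerrBilin L 0 (c⁻¹M) (c⁻¹a)` — the zoom covariance of the coordinate Ricci form
(`ricAt_comp_zoom`) for the dilation-covariant family (`bk_model_comp_smul`); `♯` is value-only.
[cite: ONeill1983, Ch. 3, Prop. 3.59] -/
theorem bk_row_scaling (L : lorentzGroup) (M a : ℝ) (A : E4 →L[ℝ] E4) (d : E4) {c : ℝ}
    (hc : 0 < c) {x : E4} (hx0 : x 0 = 0)
    (hx : 0 < Kerr.radius a (((L : E4 ≃L[ℝ] E4).symm : E4 →L[ℝ] E4) (c • x))) (e : E4) :
    ricAt (fun z : E4 ↦ boostedKerrBilin L 0 M a z + (z 0) • ((fderiv ℝ (Kerr.bilin M a) (((L : E4 ≃L[ℝ] E4).symm : E4 →L[ℝ] E4) z) (A (((L : E4 ≃L[ℝ] E4).symm : E4 →L[ℝ] E4) z) + d)).bilinearComp ((L : E4 ≃L[ℝ] E4).symm : E4 →L[ℝ] E4) ((L : E4 ≃L[ℝ] E4).symm : E4 →L[ℝ] E4) + (Kerr.bilin M a (((L : E4 ≃L[ℝ] E4).symm : E4 →L[ℝ] E4) z)).bilinearComp (A.comp ((L : E4 ≃L[ℝ]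 E4).symm : E4 →L[ℝ] E4)) ((L : E4 ≃L[ℝ] E4).symm : E4 →L[ℝ] E4) + (Kerr.bilin M a (((L : E4 ≃L[ℝ] E4).symm : E4 →L[ℝ] E4) z)).bilinearComp ((L : E4 ≃L[ℝ] E4).symm : E4 →L[ℝ] E4) (A.comp ((L : E4 ≃L[ℝ] E4).symm : E4 →L[ℝ] E4)))) (c • x)
        (sharpAt (boostedKerrBilin L 0 M a) (c • x) (E4.dx 0)) e
      = (c ^ 2)⁻¹ * ricAt (fun z : E4 ↦ boostedKerrBilin L 0 (c⁻¹ * M) (c⁻¹ * a) z + (z 0) • ((fderiv ℝ (Kerr.bilin (c⁻¹ * M) (c⁻¹ * a)) (((L : E4 ≃L[ℝ] E4).symm : E4 →L[ℝ] E4) z) ((c • A) (((L : E4 ≃L[ℝ] E4).symm : E4 →L[ℝ] E4) z) + d)).bilinearComp ((L : E4 ≃L[ℝ] E4).symm : E4 →L[ℝ] E4) ((L : E4 ≃L[ℝ] E4).symm : E4 →L[ℝ] E4) + (Kerr.bilin (c⁻¹ * M) (c⁻¹ * a) (((L : E4 ≃L[ℝ] E4).symm : E4 →L[ℝ] E4)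 z)).bilinearComp ((c • A).comp ((L : E4 ≃L[ℝ] E4).symm : E4 →L[ℝ] E4)) ((L : E4 ≃L[ℝ] E4).symm : E4 →L[ℝ] E4) + (Kerr.bilin (c⁻¹ * M) (c⁻¹ * a) (((L : E4 ≃L[ℝ] E4).symm : E4 →L[ℝ] E4) z)).bilinearComp ((L : E4 ≃L[ℝ] E4).symm : E4 →L[ℝ] E4) ((c • A).comp ((L : E4 ≃L[ℝ] E4).symm : E4 →L[ℝ] E4)))) x
        (sharpAt (boostedKerrBilin L 0 (c⁻¹ * M) (c⁻¹ * a)) x (E4.dx 0)) e := by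
  set S : E4 →L[ℝ] E4 := ((L : E4 ≃L[ℝ] E4).symm : E4 →L[ℝ] E4) with hS
  -- the modulated model with the original parameters
  obtain ⟨Φ, hΦ⟩ : ∃ Φ : E4 → E4 →L[ℝ] E4 →L[ℝ] ℝ, Φ = fun z ↦ ((fderiv ℝ (Kerr.bilin M a) (S z) (A (S z) + d)).bilinearComp S S + (Kerr.bilin M a (S z)).bilinearComp (A.comp S) S + (Kerr.bilin M a (S z)).bilinearComp S (A.comp S)) := ⟨_, rfl⟩
  set K : E4 → E4 →L[ℝ] E4 →L[ℝ] ℝ := boostedKerrBilin L 0 M a with hKdef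
  have hmodel : (fun z : E4 ↦ boostedKerrBilin L 0 M a z + (z 0) • ((fderiv ℝ (Kerr.bilin M a) (S z) (A (S z) + d)).bilinearComp S S + (Kerr.bilin M a (S z)).bilinearComp (A.comp S) S + (Kerr.bilin M a (S z)).bilinearComp S (A.comp S))) = fun z ↦ K z + (z 0) • Φ z := by
    subst hΦ; rfl
  -- `K` is a field of metric components near the slice point `c • x`
  have hKm : IsMetricOn K (poincareInv L 0 ⁻¹' (Kerr.region a 0 : Set E4)) :=
    bk_isMetricOn_boostedKerrBilin L M a
  have hcx : c • x ∈ poincareInv L 0 ⁻¹' (Kerr.region a 0 : Set E4) := (bk_mem_region_iff L a _).2 hx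
  have hcx0 : (c • x) 0 = 0 := by
    show c * x 0 = 0
    rw [hx0, mul_zero]
  obtain ⟨hU, hΦc⟩ := coerMomQ_contDiffOn_var M a S A d
  rw [← hΦ] at hΦc
  have hΦs : ∀ z ∈ {z : E4 | 0 < Kerr.radius a (S z)}, ∀ v w : E4, Φ z v w = Φ z w v :=
    fun z hz v w ↦ by rw [hΦ]; exact coerMomQ_var_symm M a S A d hz v w
  obtain ⟨V, hVo, hxV, -, -, -, hG⟩ :=
    coerMomQ_isMetricOn_add_slice_smul hKm hcx hcx0 hΦc hU hx hΦs
  -- zoom covariance about `0`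
  have hz : (0 : E4) + c • x ∈ V := by rwa [zero_add]
  have hzoom := ricAt_comp_zoom (x := (0 : E4)) hG hc.ne' hz
    (sharpAt (boostedKerrBilin L 0 M a) (c • x) (E4.dx 0)) e
  simp only [zero_add] at hzoom
  -- the composed model is the model with the dilated parameters
  have hcomp : (fun w : E4 ↦ (fun z : E4 ↦ K z + (z 0) • Φ z) (c • w)) = fun z : E4 ↦ boostedKerrBilin L 0 (c⁻¹ * M) (c⁻¹ * a) z + (z 0) • ((fderiv ℝ (Kerr.bilin (c⁻¹ * M) (c⁻¹ * a)) (S z) ((c • A) (S z) + d)).bilinearComp S S + (Kerr.bilin (c⁻¹ * M) (c⁻¹ * a) (S z)).bilinearComp ((c • A).comp S) S + (Kerr.bilin (c⁻¹ * M) (c⁻¹ * a) (S z)).bilinearComp S ((c • A).comp S)) := by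
    rw [← hmodel]
    exact bk_model_comp_smul L M a A d hc
  -- `♯` is value-only
  have hsharp : sharpAt (boostedKerrBilin L 0 M a) (c • x) (E4.dx 0) =
      sharpAt (boostedKerrBilin L 0 (c⁻¹ * M) (c⁻¹ * a)) x (E4.dx 0) := by
    simp only [sharpAt, boostedKerrBilin_smul_inv hc, smul_zero]
  rw [hmodel]
  have hc2 : c ^ 2 ≠ 0 := pow_ne_zero 2 hc.ne'
  rw [← hsharp, ← hcomp, eq_inv_mul_iff_mul_eq₀ hc2, ← hzoom]

/-- **Registered carrier** `bk_scaling_carrier` of the crux item (one-line form of a lemma of this file,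
for the `--supports` protocol). [folklore] -/
theorem bk_scaling_carrier : open Literature.Geometry.Lorentzian in ∀ {c : ℝ}, 0 < c → ∀ (M a : ℝ), Kerr.bilin (c⁻¹ * M) (c⁻¹ * a) = fun p : E4 ↦ Kerr.bilin M a (c • p) :=
  fun hc M a ↦ bk_kerr_bilin_comp_smul hc M a

end Summit.FinalStateConjecture.FinalStateConjecture.Theorems.SublinearIsFree.Slaving

end
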